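import Summits.QuantumFields.BalabanUV.T4Continuum.Support.NE7AdmissibleFibreLHC
import Summits.QuantumFields.BalabanUV.T4Continuum.Support.NE7SymmetricFermatLevels
import Summits.QuantumFields.BalabanUV.T4Continuum.Support.NE7StabiliserLiftingPrep
import Summits.QuantumFields.BalabanUV.T4Continuum.Support.NE7InvariantFunctionalLetter
import Mathlib.LinearAlgebra.Projection
import HarnessLib

/-!
# NE7SymmetricFibreLHC — THE SYMMETRIC LOWER HEMICONTINUITY OF THE ADMISSIBLE FIBRES: near an INTERIOR admissible configuration `U₀` FIXED by the lifts of a set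
# `K` of coarse gauge fields, every nearby `K`-FIXED datum is the `(k+1)`-fold average of a `K̂`-FIXED class configuration near `U₀` — F25
# `NE7AdmissibleFibreLHC.admissible_lhc` re-run on the fixed subspaces of the torus chart (letter (C_K) of the symmetric open-by-minimisation, file S1 of the
# `k`-uniform stabiliser lifting programme)

Cell `pub-balaban`, rung (B)+1 sub-cell t4, lineage `b2b-balaban-t4-ne7b-p1` (row NE7b OWNER + CRUX PROVER; junction service for row NE7, ruling
R-OWNER-149-1 (2)), generation 159.  Memo `t4/b2b-balaban-t4-ne7b-p1/g159/records/SCOPING-uniform-lifting.md` §3 (S1); the END it serves is ✓ p828980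
`NE7StabiliserLiftingUniformEnd` (letter (OPEN_K), whose step (C) this is).
THE ARGUMENT.  F25's: the constraint map `g(Φ) = levelQ L N k U₀ (chart_{U₀} Φ)` on the `𝔲(N)` torus fields `skewSub M` (`M = L·tower L N k`) is strictly
differentiable at `0` with onto differential ([tree] `hasStrictFDerivAt_levelQ`, `levelQ'_onto`).  NEW: the dressings `T_s Φ (r,κ) = Ad_{ŝ(boxVec r + e_κ)} Φ(r,κ)`
of `skewSub M` by the lifts `ŝ(x) = s(⌊x∕L^{k+1}⌋)` and `R_s` of `skewSub N` by `s` (✓ `NE7SymmetricFermatLevels.exists_adSkew`) are isometries of the Frobenius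
forms (✓ `exists_frobSkew`, `hsR_Ad`); when `ŝ` fixes `U₀`, `g` is EQUIVARIANT near `0` — `chart_{U₀}(T_s Φ) = (chart_{U₀} Φ)^{ŝ}` (✓ `NE7SymmetricFermat.chart_dress`),
`Q̄_{k+1}(W^{ŝ}) = Q̄_{k+1}(W)^{s}` (✓ `cavgIter_gaugeAct`: the corner field of `ŝ` at scale `L^{k+1}` is `s`), `relLog_{D₀}(X^{s}) = Ad_s relLog_{D₀}(X)` for
`D₀ = Q̄_{k+1}(U₀)` fixed by `s` (✓ `relLog_gaugeAct_of_fixed`), `skewPR ∘ Ad = R_s ∘ skewPR` (✓ `skewPR_Ad`) —, hence so is its differential (uniqueness of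
derivatives), and the restriction `P_{G^K} ∘ g ∘ ι_{E^K}` to the fixed subspaces `E^K ⊆ skewSub M`, `G^K ⊆ skewSub N` has ONTO differential by
✓ `NE7InvariantFunctionalLetter.exists_fixed_preimage_of_equivariant` (A2); Mathlib's `HasStrictFDerivAt.map_nhds_eq_of_surj` makes it open at `0`.  The chart
coordinate `skewPR N (relLog N D₀ D)` of a `K`-FIXED datum `D` lies in `G^K` and tends to `0` as `D → D₀`, so it is hit by a fixed chart parameter near `0`, whose
chart point is `K̂`-fixed (`chart_dress`), in the class (interiority of `U₀`), near `U₀`, and decodes to `Q̄_{k+1} = D` (F25 §2–§3).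
WHAT ([folklore]; 0 def, 0 sorry; generic `d`, every `U(n)`, `L ≥ 1`).  §1 `lift_corner`, `cavgIter_gaugeAct_lift`, `gaugeAct_cavgIter_of_lift_fixed`; §2 the abstract engine
`equivariant_open_at_zero`; §3 **`symmetric_admissible_lhc`**, **`symmetric_admissible_lhc_param`** (along a data path within a parameter set — the form F27's re-run consumes).
HONEST FRAMING (page 1): soft finite-dimensional calculus + linear algebra over F25 and gen 158's symmetric Fermat files; no estimate; nothing of Bałaban's
asserted; NOT (OPEN_K), NOT the uniform lifting, NOT NE7, NOT NE3; row NE7b NOT PRINTED ∕ NOT PROVED; spine 0∕9; finite T⁴ rung (B)+1 — NOT infinite volume, NOT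
mass gap, NOT BetaPertH, NOT Clay (continuum YM on T⁴ ⇐ BetaPertH ∧ nine spine estimates).
-/

set_option autoImplicit false

open scoped BigOperators Matrix Matrix.Norms.L2Operator Topology
open NormedSpace Finset Set Filter

namespace Summit.QuantumFields.BalabanUV.T4Continuum.NE7SymmetricFibreLHC

open Literature.MathematicalPhysics.QuantumFieldTheory.Balaban1983to89
open B7Prop1Explicit B7Prop2Explicit MatrixLog UnitaryModel MatrixNorms
open T4AveragingDeficitWall (IsUnitaryCfg IsSkewDir SmallField vary Ad)
open T4AveragingDeficitWallBoundary (IsPeriodicCfg periodBox)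
open AveragingDeficitPeriodicCounting (IsPeriodicDir)
open AveragingDeficitTorusChart (TDir redN chart chartDir chart_zero skewP skewP_of_mem skewP_mem isUnitaryCfg_chart isPeriodicCfg_chart)
open AveragingDeficitChartCalculus (cavg relLog relLog_self)
open AveragingDeficitFermat (eventually_smallField_chart)
open AveragingDeficitTwoLevelPrep (skewSub mem_skewSub skewPR)
open AveragingDeficitMultiLevelPrep (tower cavgIter levelQ levelQ' levelQ_self LevelSmall cavgIter_unitary_small isPeriodicCfg_cavgIter
  natCast_tower_succ tower_ne_zero)
open AveragingDeficitMultiLevelFermat (hasStrictFDerivAt_levelQ levelQ'_onto continuousAt_cavgIter_chart)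
open AveragingDeficitMultiLevelBridge (cavgIter_eq_avgIter tower_eq)
open MinimalActionSandwich (admissible)
open MinimalActionRate (sfClass)
open NE3EnergyShapes (IsUnitarySite IsPeriodicSite)
open NE3CpushGaugeCovariance (cavgIter_gaugeAct)
open NE3CovariantCalculus (hsR hsR_Ad)
open NE7SymmetricFermat (chart_dress)
open NE7SymmetricFermatLevels (relLog_gaugeAct_of_fixed exists_adSkew exists_frobSkew skewPR_Ad)
open NE7StabiliserLiftingPrep (isUnitarySite_lift isPeriodicSite_lift)
open NE7InvariantFunctionalLetter (mem_fixedSub_iff exists_fixed_preimage_of_equivariant)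
open NE7AdmissibleFibreLHC (continuous_chart chart_id_eq_chart_skewP eq_of_skewPR_relLog_eq tendsto_skewPR_relLog eventually_near_base)

noncomputable section

variable {d : ℕ} {n : Type*} [Fintype n] [DecidableEq n]

/-! ## §1 The block-constant lift: its corner field is the coarse field; the average of a lifted-fixed configuration is fixed -/

/-- The corner field at scale `L^{k+1}` of the block-constant lift `ŝ(x) = s(⌊x∕L^{k+1}⌋)` is `s` (`L ≥ 1`). [folklore] -/
theorem lift_corner {L : ℕ} (hL : 1 ≤ L) (k : ℕ) (s : Site d → (Matrix n n ℂ)ˣ) :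
    (fun w : Site d => (fun x : Site d => s (fun i => x i / ((L : ℤ) ^ (k + 1)))) (((L : ℤ) ^ (k + 1)) • w)) = s := by
  have hLk0 : ((L : ℤ) ^ (k + 1)) ≠ 0 := pow_ne_zero _ (by exact_mod_cast (by omega : L ≠ 0))
  funext w
  have hdiv : (fun i => (((L : ℤ) ^ (k + 1)) • w) i / ((L : ℤ) ^ (k + 1))) = w := by
    funext i
    simp only [Pi.smul_apply, smul_eq_mul]
    exact Int.mul_ediv_cancel_left _ hLk0
  show s (fun i => (((L : ℤ) ^ (k + 1)) • w) i / ((L : ℤ) ^ (k + 1))) = s w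
  rw [hdiv]

/-- **THE `(k+1)`-FOLD AVERAGE IS COVARIANT UNDER THE BLOCK-CONSTANT LIFT WITH THE COARSE FIELD AS CORNER VALUES**: for `W` unitary with `SmallField W x`,
`LevelSmall d L k x`, and `s` unitary: `Q̄_{k+1}(W^{ŝ}) = Q̄_{k+1}(W)^{s}` (✓ `cavgIter_gaugeAct` + `lift_corner`). [folklore] -/
theorem cavgIter_gaugeAct_lift [Nonempty n] {L : ℕ} (hL : 1 ≤ L) (k : ℕ) {W : Site d → Fin d → (Matrix n n ℂ)ˣ} {x : ℝ}
    (hWu : IsUnitaryCfg W) (hx : 0 ≤ x) (hls : LevelSmall d L k x) (hWx : SmallField W x) {s : Site d → (Matrix n n ℂ)ˣ} (hsu : IsUnitarySite s) :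
    cavgIter L (k + 1) (gaugeAct (fun x : Site d => s (fun i => x i / ((L : ℤ) ^ (k + 1)))) W) = gaugeAct s (cavgIter L (k + 1) W) := by
  have h := cavgIter_gaugeAct (d := d) hL k hWu hx hls hWx (u := fun x : Site d => s (fun i => x i / ((L : ℤ) ^ (k + 1))))
    (fun y => isUnitarySite_lift hsu _ y)
  rw [h, lift_corner hL k s]

/-- **THE AVERAGE OF A LIFTED-FIXED CONFIGURATION IS FIXED**: if `ŝ` fixes the unitary small `W`, then `s` fixes `Q̄_{k+1}(W)`. [folklore] -/
theorem gaugeAct_cavgIter_of_lift_fixed [Nonempty n] {L : ℕ} (hL : 1 ≤ L) (k : ℕ) {W : Site d → Fin d → (Matrix n n ℂ)ˣ} {x : ℝ}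
    (hWu : IsUnitaryCfg W) (hx : 0 ≤ x) (hls : LevelSmall d L k x) (hWx : SmallField W x) {s : Site d → (Matrix n n ℂ)ˣ} (hsu : IsUnitarySite s)
    (hfix : gaugeAct (fun x : Site d => s (fun i => x i / ((L : ℤ) ^ (k + 1)))) W = W) :
    gaugeAct s (cavgIter L (k + 1) W) = cavgIter L (k + 1) W := by
  have h := cavgIter_gaugeAct_lift (d := d) hL k hWu hx hls hWx hsu
  rw [hfix] at h
  exact h.symm

/-! ## §2 The abstract engine: an equivariant submersion at a fixed point is open from fixed vectors onto fixed vectors -/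

/-- **EQUIVARIANT OPEN MAPPING AT A FIXED POINT** (finite-dimensional real normed spaces `E`, `G`).  Let `g : E → G` be strictly differentiable at `0` with
`g 0 = 0` and ONTO differential `G′`; let `S_i` (resp. `R_i`) be continuous linear isometries of a positive-definite form `B_E` on `E` (resp. `B_G` on `G`) with
`g (S_i Φ) = R_i (g Φ)` for `Φ` near `0`.  Then for every neighbourhood `𝒱` of `0` in `E` there is a neighbourhood `O` of `0` in `G` such that every `γ ∈ O` FIXED by
all `R_i` is `g Φ` for some `Φ ∈ 𝒱` FIXED by all `S_i`.  (The restriction `P_{G^K} ∘ g ∘ ι_{E^K}` to the fixed subspaces has onto differential by (A2)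
✓ `NE7InvariantFunctionalLetter.exists_fixed_preimage_of_equivariant` — equivariance of `G′` by uniqueness of derivatives —, so Mathlib's
`HasStrictFDerivAt.map_nhds_eq_of_surj` makes it open at `0`.) [folklore] -/
theorem equivariant_open_at_zero {E G : Type*} [NormedAddCommGroup E] [NormedSpace ℝ E] [FiniteDimensional ℝ E]
    [NormedAddCommGroup G] [NormedSpace ℝ G] [FiniteDimensional ℝ G] {ι' : Type*}
    (BE : E →ₗ[ℝ] E →ₗ[ℝ] ℝ) (hBE : ∀ v : E, v ≠ 0 → 0 < BE v v) (BG : G →ₗ[ℝ] G →ₗ[ℝ] ℝ) (hBG : ∀ w : G, w ≠ 0 → 0 < BG w w)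
    (S : ι' → E →L[ℝ] E) (R : ι' → G →L[ℝ] G)
    (hS : ∀ i, ∀ v w : E, BE (S i v) (S i w) = BE v w) (hR : ∀ i, ∀ v w : G, BG (R i v) (R i w) = BG v w)
    {g : E → G} {G' : E →L[ℝ] G} (hg : HasStrictFDerivAt g G' 0) (hg0 : g 0 = 0) (hsurj : Function.Surjective G')
    (hequiv : ∀ᶠ Φ in 𝓝 (0 : E), ∀ i, g (S i Φ) = R i (g Φ))
    {𝒱 : Set E} (h𝒱 : 𝒱 ∈ 𝓝 (0 : E)) :
    ∃ O ∈ 𝓝 (0 : G), ∀ γ ∈ O, (∀ i, R i γ = γ) → ∃ Φ ∈ 𝒱, (∀ i, S i Φ = Φ) ∧ g Φ = γ := by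
  classical
  haveI : CompleteSpace E := FiniteDimensional.complete ℝ _
  haveI : CompleteSpace G := FiniteDimensional.complete ℝ _
  -- the fixed subspaces
  set EK : Submodule ℝ E := ⨅ i : ι', LinearMap.ker (((S i : E →L[ℝ] E) : E →ₗ[ℝ] E) - LinearMap.id) with hEK
  have hmemEK : ∀ Φ : E, Φ ∈ EK ↔ ∀ i, S i Φ = Φ := fun Φ => by
    rw [hEK, mem_fixedSub_iff]; simp only [ContinuousLinearMap.coe_coe]
  set GK : Submodule ℝ G := ⨅ i : ι', LinearMap.ker (((R i : G →L[ℝ] G) : G →ₗ[ℝ] G) - LinearMap.id) with hGK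
  have hmemGK : ∀ γ : G, γ ∈ GK ↔ ∀ i, R i γ = γ := fun γ => by
    rw [hGK, mem_fixedSub_iff]; simp only [ContinuousLinearMap.coe_coe]
  haveI : CompleteSpace ↥EK := FiniteDimensional.complete ℝ _
  haveI : CompleteSpace ↥GK := FiniteDimensional.complete ℝ _
  obtain ⟨GK', hGK'⟩ := GK.exists_isCompl
  let P : G →L[ℝ] ↥GK := LinearMap.toContinuousLinearMap (Submodule.projectionOnto GK GK' hGK')
  have hP : ∀ γ : ↥GK, P (γ : G) = γ := fun γ => Submodule.projectionOnto_apply_left hGK' γ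
  let ι : ↥EK →L[ℝ] E := EK.subtypeL
  have hι0 : ι 0 = 0 := map_zero ι
  -- equivariance of the differential (uniqueness of derivatives)
  have hequiv' : ∀ (i : ι') (Φ : E), G' (S i Φ) = R i (G' Φ) := by
    intro i Φ
    have h1 : HasFDerivAt (fun Φ => g (S i Φ)) (G'.comp (S i)) 0 := by
      have h := hg.hasFDerivAt
      rw [← show S i 0 = 0 from map_zero (S i)] at h
      exact h.comp 0 (S i).hasFDerivAt
    have h2 : HasFDerivAt (fun Φ => R i (g Φ)) ((R i).comp G') 0 := (R i).hasFDerivAt.comp 0 hg.hasFDerivAt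
    have h3 : HasFDerivAt (fun Φ => R i (g Φ)) (G'.comp (S i)) 0 := by
      refine h1.congr_of_eventuallyEq ?_
      filter_upwards [hequiv] with Φ hΦ
      exact (hΦ i).symm
    have heq := h3.unique h2
    have := congrArg (fun A : E →L[ℝ] G => A Φ) heq
    simpa only [ContinuousLinearMap.comp_apply] using this
  -- the restricted map and its ONTO differential
  set f : ↥EK → ↥GK := fun θ => P (g (ι θ)) with hf
  have hfd : HasStrictFDerivAt f (P.comp (G'.comp ι)) 0 := by
    have h := hg
    rw [← hι0] at h
    exact P.hasStrictFDerivAt.comp 0 (h.comp 0 ι.hasStrictFDerivAt)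
  have hsurjK : Function.Surjective (P.comp (G'.comp ι)) := by
    intro γ
    obtain ⟨Φ, hΦS, hΦT⟩ := exists_fixed_preimage_of_equivariant BE hBE BG hBG
      (fun i : ι' => ((S i : E →L[ℝ] E) : E →ₗ[ℝ] E)) (fun i : ι' => ((R i : G →L[ℝ] G) : G →ₗ[ℝ] G))
      (fun i v w => hS i v w) (fun i v w => hR i v w) (G' : E →ₗ[ℝ] G) hsurj (fun i Φ => hequiv' i Φ) (γ : G)
      (fun i => (hmemGK _).1 γ.2 i)
    refine ⟨⟨Φ, (hmemEK Φ).2 hΦS⟩, ?_⟩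
    rw [ContinuousLinearMap.comp_apply, ContinuousLinearMap.comp_apply]
    have h1 : G' (ι ⟨Φ, (hmemEK Φ).2 hΦS⟩) = (γ : G) := hΦT
    rw [h1, hP]
  have hrangeK : (P.comp (G'.comp ι)).range = ⊤ := LinearMap.range_eq_top.mpr hsurjK
  have hf0 : f 0 = 0 := by simp only [hf, hι0, hg0, map_zero]
  have hmap : map f (𝓝 0) = 𝓝 0 := by simpa only [hf0] using hfd.map_nhds_eq_of_surj hrangeK
  -- the good fixed parameters: in `𝒱` and inside the equivariance region
  have hιt : Tendsto (fun θ : ↥EK => ι θ) (𝓝 0) (𝓝 0) := by simpa only [hι0] using ι.continuous.tendsto 0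
  obtain ⟨𝒲, h𝒲, h𝒲sub⟩ : ∃ 𝒲 ∈ 𝓝 (0 : ↥EK), ∀ θ ∈ 𝒲, ι θ ∈ 𝒱 ∧ ∀ i, g (S i (ι θ)) = R i (g (ι θ)) :=
    Filter.Eventually.exists_mem (hιt.eventually ((Filter.inter_mem h𝒱 hequiv)) |>.mono fun θ h => ⟨h.1, h.2⟩)
  have hfW : f '' 𝒲 ∈ 𝓝 (0 : ↥GK) := by rw [← hmap]; exact image_mem_map h𝒲
  obtain ⟨O, hO, hOsub⟩ := (mem_nhds_subtype _ (0 : ↥GK) _).mp hfW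
  have hO' : O ∈ 𝓝 (0 : G) := by simpa using hO
  refine ⟨O, hO', fun γ hγO hγfix => ?_⟩
  have hγGK : γ ∈ GK := (hmemGK γ).2 hγfix
  have hmem : (⟨γ, hγGK⟩ : ↥GK) ∈ f '' 𝒲 := hOsub (by simpa using hγO)
  obtain ⟨θ, hθ𝒲, hfθ⟩ := hmem
  obtain ⟨hθ𝒱, hθequiv⟩ := h𝒲sub θ hθ𝒲
  have hθfix : ∀ i, S i (ι θ) = ι θ := (hmemEK _).1 θ.2
  have hgGK : g (ι θ) ∈ GK := by
    rw [hmemGK]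
    intro i
    have h1 := hθequiv i
    rw [hθfix i] at h1
    exact h1.symm
  have hgeq : g (ι θ) = γ := by
    have h1 : f θ = ⟨g (ι θ), hgGK⟩ := by
      simp only [hf]
      exact hP ⟨g (ι θ), hgGK⟩
    rw [h1] at hfθ
    exact congrArg Subtype.val hfθ
  exact ⟨ι θ, hθ𝒱, hθfix, hgeq⟩

/-! ## §3 The symmetric lower hemicontinuity -/

/-- **SYMMETRIC LOWER HEMICONTINUITY OF THE ADMISSIBLE FIBRES AT AN INTERIOR FIXED CONFIGURATION.**  `L ≥ 1`, `ε ≥ 0`, `LevelSmall d L k (ε(L^{k+1})^{−2})`;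
`U₀ ∈ admissible (sfClass d L N ε) L (k+1) D₀` with `SmallField U₀ a`, `a < ε(L^{k+1})^{−2}` (INTERIOR); `K` a set of unitary `N`-periodic coarse gauge fields whose
block-constant lifts `ŝ(x) = s(⌊x∕L^{k+1}⌋)` FIX `U₀`.  Then for every neighbourhood `𝒰` of `U₀`, EVENTUALLY as the datum `D → D₀`: if `D` is unitary, `N`-periodic and
FIXED by every `s ∈ K`, some `U ∈ 𝒰` is admissible for `D` AND FIXED by every lift `ŝ`, `s ∈ K`. [folklore] -/
theorem symmetric_admissible_lhc [Nonempty n] {L N k : ℕ} [NeZero L] [NeZero N] (hL : 1 ≤ L) {ε a : ℝ} (hε : 0 ≤ ε)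
    (hls : LevelSmall d L k (ε / ((L : ℝ) ^ (k + 1)) ^ 2)) {D₀ U₀ : Site d → Fin d → (Matrix n n ℂ)ˣ}
    (hU₀ : U₀ ∈ admissible (sfClass d L N ε) L (k + 1) D₀) (haε : a < ε / ((L : ℝ) ^ (k + 1)) ^ 2) (hU₀a : SmallField U₀ a)
    (K : Set (Site d → (Matrix n n ℂ)ˣ)) (hKu : ∀ s ∈ K, IsUnitarySite s) (hKP : ∀ s ∈ K, IsPeriodicSite s (N : ℤ))
    (hKfix : ∀ s ∈ K, gaugeAct (fun x : Site d => s (fun i => x i / ((L : ℤ) ^ (k + 1)))) U₀ = U₀)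
    {𝒰 : Set (Site d → Fin d → (Matrix n n ℂ)ˣ)} (h𝒰 : 𝒰 ∈ 𝓝 U₀) :
    ∀ᶠ D in 𝓝 D₀, IsUnitaryCfg D → IsPeriodicCfg D (N : ℤ) → (∀ s ∈ K, gaugeAct s D = D) →
      ∃ U ∈ 𝒰, U ∈ admissible (sfClass d L N ε) L (k + 1) D ∧
        ∀ s ∈ K, gaugeAct (fun x : Site d => s (fun i => x i / ((L : ℤ) ^ (k + 1)))) U = U := by
  classical
  set M : ℕ := L * tower L N k with hMdef
  haveI : NeZero M := ⟨by rw [hMdef]; exact Nat.mul_ne_zero (NeZero.ne L) (tower_ne_zero L N k)⟩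
  set x : ℝ := ε / ((L : ℝ) ^ (k + 1)) ^ 2 with hxdef
  have hx : 0 ≤ x := by rw [hxdef]; positivity
  obtain ⟨⟨hU₀u, hU₀P, hU₀x⟩, hU₀avg⟩ := hU₀
  have hLk : 1 ≤ L ^ (k + 1) := Nat.one_le_pow _ _ hL
  have eP : ((N * L ^ (k + 1) : ℕ) : ℤ) = (L : ℤ) * (tower L N k : ℕ) := by rw [tower_eq]; push_cast; ring
  have ePM : ((N * L ^ (k + 1) : ℕ) : ℤ) = (M : ℤ) := by rw [hMdef]; push_cast; rw [tower_eq]; push_cast; ring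
  have hU₀P' : IsPeriodicCfg U₀ ((L : ℤ) * (tower L N k : ℕ)) := by rw [← eP]; exact hU₀P
  have hU₀PM : IsPeriodicCfg U₀ (M : ℤ) := by rw [← ePM]; exact hU₀P
  -- the base datum `Q̄_{k+1}(U₀) = D₀`: unitary, fixed by every `s ∈ K`
  have hcD : cavgIter L (k + 1) U₀ = D₀ := by rw [cavgIter_eq_avgIter]; exact hU₀avg
  have hD₀u : IsUnitaryCfg D₀ := by
    obtain ⟨h, -, -⟩ := cavgIter_unitary_small hL k hU₀u hx hls hU₀x
    rwa [hcD] at h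
  have hD₀fix : ∀ s ∈ K, gaugeAct s D₀ = D₀ := by
    intro s hs
    have h := gaugeAct_cavgIter_of_lift_fixed (d := d) hL k hU₀u hx hls hU₀x (hKu s hs) (hKfix s hs)
    rwa [hcD] at h
  -- the lifts: unitary, `M`-periodic site fields fixing `U₀`
  have hliftu : ∀ s ∈ K, IsUnitarySite (fun x : Site d => s (fun i => x i / ((L : ℤ) ^ (k + 1)))) :=
    fun s hs => fun y => isUnitarySite_lift (hKu s hs) _ y
  have hliftP : ∀ s ∈ K, IsPeriodicSite (fun x : Site d => s (fun i => x i / ((L : ℤ) ^ (k + 1)))) (M : ℤ) := by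
    intro s hs
    have h := isPeriodicSite_lift (d := d) (hKP s hs) (M := L ^ (k + 1)) hLk
    have hc : ((L ^ (k + 1) : ℕ) : ℤ) = (L : ℤ) ^ (k + 1) := by push_cast; ring
    simp only [hc] at h
    rw [ePM] at h
    exact h
  -- F25 §4: the constraint map on the `𝔲(N)` torus fields and its onto strict differential
  haveI : CompleteSpace ↥(skewSub d n M) := FiniteDimensional.complete ℝ _
  haveI : CompleteSpace ↥(skewSub d n N) := FiniteDimensional.complete ℝ _
  set g : ↥(skewSub d n M) → ↥(skewSub d n N) := fun Φ =>
    levelQ L N k U₀ (chart (ContinuousLinearMap.id ℝ (Matrix n n ℂ)) M U₀ (Φ : TDir d n M)) with hg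
  set G' : ↥(skewSub d n M) →L[ℝ] ↥(skewSub d n N) := (levelQ' L N k U₀).comp (skewSub d n M).subtypeL with hG'
  have hQ := hasStrictFDerivAt_levelQ (d := d) (n := n) (M' := N) hL k hU₀u hU₀P' hx hls hU₀x
  have hGd : HasStrictFDerivAt g G' 0 := by
    exact HasStrictFDerivAt.comp (0 : ↥(skewSub d n M)) (by simpa using hQ) ((skewSub d n M).subtypeL).hasStrictFDerivAt
  have hG'surj : Function.Surjective G' := by
    intro γ
    obtain ⟨Φ, hΦs, hΦ⟩ := levelQ'_onto (d := d) (n := n) (M' := N) hL k hU₀u hU₀P' hx hls hU₀x γ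
    exact ⟨⟨Φ, mem_skewSub.mpr hΦs⟩, by rw [hG']; simpa using hΦ⟩
  have hg0 : g 0 = 0 := by simp only [hg, Submodule.coe_zero, chart_zero, levelQ_self]
  -- the dressings `T_s` of `skewSub M` (by the lifts) and `R_s` of `skewSub N` (by `s`), `s ∈ K`
  have hTex : ∀ s : ↥K, ∃ T : ↥(skewSub d n M) →L[ℝ] ↥(skewSub d n M), ∀ (Φ : ↥(skewSub d n M)) (r : Fin d → Fin M) (κ : Fin d),
      ((T Φ : ↥(skewSub d n M)) : TDir d n M) r κ
        = Ad ((fun x : Site d => (s : Site d → (Matrix n n ℂ)ˣ) (fun i => x i / ((L : ℤ) ^ (k + 1)))) (boxVec M r + e κ)) ((Φ : TDir d n M) r κ) :=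
    fun s => exists_adSkew M (w := fun r κ => (fun x : Site d => (s : Site d → (Matrix n n ℂ)ˣ) (fun i => x i / ((L : ℤ) ^ (k + 1)))) (boxVec M r + e κ))
      fun r κ => hliftu s s.2 _
  choose T hT using hTex
  have hRex : ∀ s : ↥K, ∃ R : ↥(skewSub d n N) →L[ℝ] ↥(skewSub d n N), ∀ (γ : ↥(skewSub d n N)) (r : Fin d → Fin N) (κ : Fin d),
      ((R γ : ↥(skewSub d n N)) : TDir d n N) r κ = Ad ((s : Site d → (Matrix n n ℂ)ˣ) (boxVec N r + e κ)) ((γ : TDir d n N) r κ) :=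
    fun s => exists_adSkew N (w := fun r κ => (s : Site d → (Matrix n n ℂ)ˣ) (boxVec N r + e κ)) fun r κ => hKu s s.2 _
  choose R hR using hRex
  obtain ⟨BE, hBE, hBEpos⟩ := exists_frobSkew (d := d) (n := n) M
  obtain ⟨BG, hBG, hBGpos⟩ := exists_frobSkew (d := d) (n := n) N
  have hTiso : ∀ (s : ↥K) (Φ Ψ : ↥(skewSub d n M)), BE (T s Φ) (T s Ψ) = BE Φ Ψ := fun s Φ Ψ => by
    rw [hBE, hBE]
    exact sum_congr rfl fun r _ => sum_congr rfl fun κ _ => by rw [hT s, hT s]; exact hsR_Ad (hliftu s s.2 _) _ _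
  have hRiso : ∀ (s : ↥K) (γ γ' : ↥(skewSub d n N)), BG (R s γ) (R s γ') = BG γ γ' := fun s γ γ' => by
    rw [hBG, hBG]
    exact sum_congr rfl fun r _ => sum_congr rfl fun κ _ => by rw [hR s, hR s]; exact hsR_Ad (hKu s s.2 _) _ _
  -- the chart on the torus fields; the dressed chart point is the gauge transform of the chart point
  set ch : ↥(skewSub d n M) → (Site d → Fin d → (Matrix n n ℂ)ˣ) := fun Φ =>
    chart (ContinuousLinearMap.id ℝ (Matrix n n ℂ)) M U₀ (Φ : TDir d n M) with hch
  have hchT : ∀ (s : ↥K) (Φ : ↥(skewSub d n M)),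
      ch (T s Φ) = gaugeAct (fun x : Site d => (s : Site d → (Matrix n n ℂ)ˣ) (fun i => x i / ((L : ℤ) ^ (k + 1)))) (ch Φ) := by
    intro s Φ
    have hcoe : ((T s Φ : ↥(skewSub d n M)) : TDir d n M)
        = fun r κ => Ad ((fun x : Site d => (s : Site d → (Matrix n n ℂ)ˣ) (fun i => x i / ((L : ℤ) ^ (k + 1)))) (boxVec M r + e κ)) ((Φ : TDir d n M) r κ) := by
      funext r κ; exact hT s Φ r κ
    simp only [hch]
    rw [chart_id_eq_chart_skewP U₀ (T s Φ).2, chart_id_eq_chart_skewP U₀ Φ.2, hcoe]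
    exact chart_dress M (hliftu s s.2) (hliftP s s.2) (hKfix s s.2) (Φ : TDir d n M)
  -- EQUIVARIANCE of `g` on the small-field part of the chart, hence near `0`
  have hequivAt : ∀ (s : ↥K) (Φ : ↥(skewSub d n M)), SmallField (ch Φ) x → g (T s Φ) = R s (g Φ) := by
    intro s Φ hΦx
    have hWu : IsUnitaryCfg (ch Φ) := by
      show IsUnitaryCfg (chart (ContinuousLinearMap.id ℝ (Matrix n n ℂ)) M U₀ (Φ : TDir d n M))
      rw [chart_id_eq_chart_skewP U₀ Φ.2]
      exact isUnitaryCfg_chart M hU₀u _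
    have h1 : cavgIter L (k + 1) (ch (T s Φ)) = gaugeAct (s : Site d → (Matrix n n ℂ)ˣ) (cavgIter L (k + 1) (ch Φ)) := by
      rw [hchT]
      exact cavgIter_gaugeAct_lift (d := d) hL k hWu hx hls hΦx (hKu s s.2)
    show skewPR N (relLog N (cavgIter L (k + 1) U₀) (cavgIter L (k + 1) (ch (T s Φ))))
      = R s (skewPR N (relLog N (cavgIter L (k + 1) U₀) (cavgIter L (k + 1) (ch Φ))))
    rw [h1, hcD, relLog_gaugeAct_of_fixed N (hD₀fix s s.2)]
    exact skewPR_Ad N (fun r κ => hKu s s.2 _) (hR s) _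
  have hval0 : Tendsto (fun Φ : ↥(skewSub d n M) => (Φ : TDir d n M)) (𝓝 0) (𝓝 0) := by
    simpa only [Submodule.coe_zero] using continuous_subtype_val.tendsto (0 : ↥(skewSub d n M))
  have hsmallE : ∀ᶠ Φ : ↥(skewSub d n M) in 𝓝 0, SmallField (ch Φ) x :=
    hval0.eventually (eventually_smallField_chart (ContinuousLinearMap.id ℝ (Matrix n n ℂ)) M hU₀PM haε hU₀a)
  have hequivE : ∀ᶠ Φ : ↥(skewSub d n M) in 𝓝 0, ∀ s : ↥K, g (T s Φ) = R s (g Φ) :=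
    hsmallE.mono fun Φ hΦ s => hequivAt s Φ hΦ
  -- the chart: continuity at `0`
  have hchc : Continuous ch := (continuous_chart (ContinuousLinearMap.id ℝ (Matrix n n ℂ)) M U₀).comp continuous_subtype_val
  have hch0 : ch 0 = U₀ := by simp only [hch, Submodule.coe_zero, chart_zero]
  -- the good chart parameters: image in `𝒰`, in the class radius, top average bondwise near `D₀`
  have hV1 : ∀ᶠ Φ : ↥(skewSub d n M) in 𝓝 0, ch Φ ∈ 𝒰 := by
    have h := hchc.tendsto (0 : ↥(skewSub d n M)); rw [hch0] at h; exact h h𝒰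
  have hV3' : ∀ᶠ θ : TDir d n M in 𝓝 0, ∀ (r : Fin d → Fin N) (κ : Fin d),
      ‖(((D₀ (boxVec N r) κ)⁻¹ : (Matrix n n ℂ)ˣ) : Matrix n n ℂ)
        * (cavgIter L (k + 1) (chart (ContinuousLinearMap.id ℝ (Matrix n n ℂ)) M U₀ θ) (boxVec N r) κ : Matrix n n ℂ) - 1‖ ≤ 1 / 4 := by
    refine Filter.eventually_all.mpr fun r => Filter.eventually_all.mpr fun κ => ?_
    have hc0 := continuousAt_cavgIter_chart (d := d) (n := n) hL N k (ContinuousLinearMap.id ℝ (Matrix n n ℂ)) hU₀u hU₀P' hx hls hU₀x (boxVec N r) κ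
    have hc : ContinuousAt (fun θ : TDir d n M =>
        ‖(((D₀ (boxVec N r) κ)⁻¹ : (Matrix n n ℂ)ˣ) : Matrix n n ℂ)
          * ((cavgIter L (k + 1) (chart (ContinuousLinearMap.id ℝ (Matrix n n ℂ)) M U₀ θ) (boxVec N r) κ : (Matrix n n ℂ)ˣ) : Matrix n n ℂ) - 1‖) 0 :=
      ((continuousAt_const.mul hc0).sub continuousAt_const).norm
    have h0 : ‖(((D₀ (boxVec N r) κ)⁻¹ : (Matrix n n ℂ)ˣ) : Matrix n n ℂ)
        * ((cavgIter L (k + 1) (chart (ContinuousLinearMap.id ℝ (Matrix n n ℂ)) M U₀ 0) (boxVec N r) κ : (Matrix n n ℂ)ˣ) : Matrix n n ℂ) - 1‖ < 1 / 4 := by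
      rw [chart_zero, hcD, Units.inv_mul, sub_self, norm_zero]
      norm_num
    exact (hc.eventually (gt_mem_nhds h0)).mono fun θ hθ => hθ.le
  have hV3 : ∀ᶠ Φ : ↥(skewSub d n M) in 𝓝 0, ∀ (r : Fin d → Fin N) (κ : Fin d),
      ‖(((D₀ (boxVec N r) κ)⁻¹ : (Matrix n n ℂ)ˣ) : Matrix n n ℂ) * (cavgIter L (k + 1) (ch Φ) (boxVec N r) κ : Matrix n n ℂ) - 1‖ ≤ 1 / 4 :=
    hval0.eventually hV3'
  obtain ⟨𝒱, h𝒱, h𝒱sub⟩ : ∃ 𝒱 ∈ 𝓝 (0 : ↥(skewSub d n M)), ∀ Φ ∈ 𝒱, ch Φ ∈ 𝒰 ∧ SmallField (ch Φ) x ∧ ∀ (r : Fin d → Fin N) (κ : Fin d),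
      ‖(((D₀ (boxVec N r) κ)⁻¹ : (Matrix n n ℂ)ˣ) : Matrix n n ℂ) * (cavgIter L (k + 1) (ch Φ) (boxVec N r) κ : Matrix n n ℂ) - 1‖ ≤ 1 / 4 :=
    Filter.Eventually.exists_mem ((hV1.and hsmallE).and hV3 |>.mono fun Φ h => ⟨h.1.1, h.1.2, h.2⟩)
  -- the abstract engine: every small FIXED coordinate is `g` of a FIXED parameter in `𝒱`
  obtain ⟨O, hO, hOfix⟩ := equivariant_open_at_zero BE hBEpos BG hBGpos T R hTiso hRiso hGd hg0 hG'surj hequivE h𝒱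
  have hcoord : ∀ᶠ D in 𝓝 D₀, skewPR N (relLog N D₀ D) ∈ O := tendsto_skewPR_relLog (d := d) (n := n) N D₀ hO
  have hnear := eventually_near_base (d := d) (n := n) N D₀
  filter_upwards [hcoord, hnear] with D hD hDnear hDu hDP hDfix
  -- the coordinate of the FIXED datum is fixed by every `R_s`
  have hcfix : ∀ s : ↥K, R s (skewPR N (relLog N D₀ D)) = skewPR N (relLog N D₀ D) := by
    intro s
    have h1 := relLog_gaugeAct_of_fixed N (hD₀fix s s.2) D
    rw [hDfix s s.2] at h1
    have h2 := skewPR_Ad N (fun r κ => hKu s s.2 _) (hR s) (relLog N D₀ D)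
    rw [← h1] at h2
    exact h2.symm
  obtain ⟨Φ, hΦ𝒱, hΦfix, hgΦ⟩ := hOfix _ hD hcfix
  obtain ⟨hΦ𝒰, hΦx, hΦnear⟩ := h𝒱sub Φ hΦ𝒱
  refine ⟨ch Φ, hΦ𝒰, ?_, ?_⟩
  · -- the chart point is in the class and its top average is `D` (F25's decoding)
    have hΦs : (Φ : TDir d n M) ∈ skewSub d n M := Φ.2
    have hchu : IsUnitaryCfg (ch Φ) := by
      show IsUnitaryCfg (chart (ContinuousLinearMap.id ℝ (Matrix n n ℂ)) M U₀ (Φ : TDir d n M))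
      rw [chart_id_eq_chart_skewP U₀ hΦs]
      exact isUnitaryCfg_chart M hU₀u _
    have hchP : IsPeriodicCfg (ch Φ) ((N * L ^ (k + 1) : ℕ) : ℤ) := by
      rw [ePM]
      exact isPeriodicCfg_chart (ContinuousLinearMap.id ℝ (Matrix n n ℂ)) M hU₀PM _
    have hmem : ch Φ ∈ sfClass d L N ε (k + 1) := ⟨hchu, hchP, hΦx⟩
    refine ⟨hmem, ?_⟩
    have hchPt : IsPeriodicCfg (ch Φ) ((tower L N (k + 1) : ℕ) : ℤ) := by
      rw [natCast_tower_succ, ← eP]; exact hchP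
    obtain ⟨hXu, -, -⟩ := cavgIter_unitary_small hL k hchu hx hls hΦx
    have hXP : IsPeriodicCfg (cavgIter L (k + 1) (ch Φ)) (N : ℤ) := isPeriodicCfg_cavgIter L N (k + 1) hchPt
    have hQ : skewPR N (relLog N (cavgIter L (k + 1) U₀) (cavgIter L (k + 1) (ch Φ))) = skewPR N (relLog N D₀ D) := hgΦ
    rw [hcD] at hQ
    have heq : cavgIter L (k + 1) (ch Φ) = D := eq_of_skewPR_relLog_eq hXP hDP hD₀u hXu hDu hΦnear hDnear hQ
    rw [← cavgIter_eq_avgIter]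
    exact heq
  · -- the chart point is fixed by every lift
    intro s hs
    have h1 := hchT ⟨s, hs⟩ Φ
    rw [hΦfix ⟨s, hs⟩] at h1
    exact h1.symm

/-- **SYMMETRIC LOWER HEMICONTINUITY ALONG A DATA PATH** (the form the symmetric open-by-minimisation consumes): `γ` continuous at `τ₀` within `S` with
unitary `N`-periodic `K`-FIXED values on `S`, `U₀` an INTERIOR admissible configuration for `γ τ₀` fixed by the lifts of `K` ⟹ for every neighbourhood `𝒰`
of `U₀`, eventually for `τ → τ₀` in `S`, SOME `U ∈ 𝒰` fixed by the lifts of `K` is admissible for `γ τ`. [folklore] -/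
theorem symmetric_admissible_lhc_param [Nonempty n] {L N k : ℕ} [NeZero L] [NeZero N] (hL : 1 ≤ L) {ε a : ℝ} (hε : 0 ≤ ε)
    (hls : LevelSmall d L k (ε / ((L : ℝ) ^ (k + 1)) ^ 2)) {Pτ : Type*} [TopologicalSpace Pτ] {S : Set Pτ}
    {γ : Pτ → (Site d → Fin d → (Matrix n n ℂ)ˣ)} {τ₀ : Pτ} (hγ : ContinuousWithinAt γ S τ₀)
    (hγu : ∀ τ ∈ S, IsUnitaryCfg (γ τ)) (hγP : ∀ τ ∈ S, IsPeriodicCfg (γ τ) (N : ℤ))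
    (K : Set (Site d → (Matrix n n ℂ)ˣ)) (hKu : ∀ s ∈ K, IsUnitarySite s) (hKP : ∀ s ∈ K, IsPeriodicSite s (N : ℤ))
    (hγK : ∀ τ ∈ S, ∀ s ∈ K, gaugeAct s (γ τ) = γ τ)
    {U₀ : Site d → Fin d → (Matrix n n ℂ)ˣ} (hU₀ : U₀ ∈ admissible (sfClass d L N ε) L (k + 1) (γ τ₀))
    (haε : a < ε / ((L : ℝ) ^ (k + 1)) ^ 2) (hU₀a : SmallField U₀ a)
    (hU₀fix : ∀ s ∈ K, gaugeAct (fun x : Site d => s (fun i => x i / ((L : ℤ) ^ (k + 1)))) U₀ = U₀)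
    {𝒰 : Set (Site d → Fin d → (Matrix n n ℂ)ˣ)} (h𝒰 : 𝒰 ∈ 𝓝 U₀) :
    ∀ᶠ τ in 𝓝[S] τ₀, ∃ U ∈ 𝒰, U ∈ admissible (sfClass d L N ε) L (k + 1) (γ τ) ∧
      ∀ s ∈ K, gaugeAct (fun x : Site d => s (fun i => x i / ((L : ℤ) ^ (k + 1)))) U = U := by
  have h := hγ.tendsto.eventually (symmetric_admissible_lhc (N := N) hL hε hls hU₀ haε hU₀a K hKu hKP hU₀fix h𝒰)
  filter_upwards [h, self_mem_nhdsWithin] with τ hτ hτS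
  exact hτ (hγu τ hτS) (hγP τ hτS) (hγK τ hτS)

end

end Summit.QuantumFields.BalabanUV.T4Continuum.NE7SymmetricFibreLHC
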